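import Summits.QuantumAdvantage.QuantumAdvantage.Theorems.CubicForrelationNearExactIsExactFourteenLevelSixPrep

/-!
# The Pfaffian carry of the quadratic digit on 4-flats (NearExactIsExact, disprover gen 24)

Negative/structural lemmas for the crux `CubicForrelation.NearExactIsExact` (item r2), finite slice `n = 14`.
HONEST FRAMING: statements about cubic Boolean functions on 14 bits — NOT summit progress; no violation of `NearExactIsExact`.

Setting (type T, cf. `…Negative.TightTypeTFourteen`): `g` cubic on 14 bits, `W_g = 32u`, and `u ≡ 5 − 2q − 4e (mod 8)` pointwise
for a QUADRATIC `q` (the digit `d₁`) and a Boolean `e` (the indicator of `E = {d₁ = d₂}`).  Write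
`B(y,z) = q(0) ⊕ q(y) ⊕ q(z) ⊕ q(y ⊕ z)` for the alternating form of `q` and
`Pf(t;a,b,c) = B(t,a)B(b,c) ⊕ B(t,b)B(a,c) ⊕ B(t,c)B(a,b)` for its Pfaffian 4-form.
* `pp_q16` (pure quadratic algebra, an 11-bit identity): on every 4-flat `p ⊕ ⟨t,a,b,c⟩` the number of ones of `q` is
  `≡ 2·Pf(t;a,b,c) (mod 4)` — the "carry" of `2q` in `ℤ/8`.
* `pp_pair_sum`: a `t`-periodic summand sums over `p ⊕ ⟨t,a,b,c⟩` to twice its sum over `p ⊕ ⟨a,b,c⟩`.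
* `pp_period_pf`: since `8 ∣ Σ_{4-flat} u` (`fs_flat_sum_dvd`), `parity(Σ_{flat} e) = Pf`; so if `t` is a PERIOD of `e` then
  `Pf(t;a,b,c) = 0` for all `a, b, c` (i.e. the quartic part of `e` is the Pfaffian form of `q`, and `ι_t Pf = 0` along periods).
Sources: [this work]; F. J. MacWilliams, N. J. A. Sloane (1977) Ch. 15 (second-order RM / symplectic forms).  Standard axioms only.
-/

set_option linter.dupNamespace false -- D-0017: single-problem summit ⇒ `QuantumAdvantage.QuantumAdvantage` by design

noncomputable section

namespace Summit.QuantumAdvantage.QuantumAdvantage.Theorems.NearExactIsExact.Negative.PfaffianPeriodFourteen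

open Finset
open Literature.Computability.QuantumComplexity
open Literature.Computability.QuantumComplexity.BuzetChailloux (bxor zeroVec)
open Literature.Computability.QuantumComplexity.DerivativeWalsh (W)
open Summit.QuantumAdvantage.QuantumAdvantage.Theorems.CubicForrelation.NearExactIsExact

variable {n : ℕ}

/-- **Pairing along a period.**  If `F(x ⊕ t) = F(x)` for all `x`, the sum of `F` over the (parametrised) 4-flat
`p ⊕ ⟨t, a₀, a₁, a₂⟩` is twice its sum over `p ⊕ ⟨a₀, a₁, a₂⟩`.  NOT summit progress. [this work] -/
theorem pp_pair_sum (F : (Fin n → Bool) → ℤ) (p t : Fin n → Bool) (A : Fin 3 → Fin n → Bool)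
    (hF : ∀ x, F (bxor x t) = F x) :
    ∑ ε : Fin 4 → Bool, F (fun l => p l ^^ decide (Odd #(univ.filter fun i : Fin 4 =>
        ε i && (Fin.cons t A : Fin 4 → Fin n → Bool) i l))) =
      2 * ∑ ε : Fin 3 → Bool, F (fun l => p l ^^ decide (Odd #(univ.filter fun i : Fin 3 => ε i && A i l))) := by
  rw [tep_sum_split]
  have h0 : ∀ ε : Fin 3 → Bool, F (fun l => p l ^^ decide (Odd #(univ.filter fun i : Fin 4 =>
      (Fin.cons false ε : Fin 4 → Bool) i && (Fin.cons t A : Fin 4 → Fin n → Bool) i l))) =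
      F (fun l => p l ^^ decide (Odd #(univ.filter fun i : Fin 3 => ε i && A i l))) := by
    intro ε
    rw [erm_flatPt_cons]
    simp only [Bool.false_and, Bool.xor_false]
  have h1 : ∀ ε : Fin 3 → Bool, F (fun l => p l ^^ decide (Odd #(univ.filter fun i : Fin 4 =>
      (Fin.cons true ε : Fin 4 → Bool) i && (Fin.cons t A : Fin 4 → Fin n → Bool) i l))) =
      F (fun l => p l ^^ decide (Odd #(univ.filter fun i : Fin 3 => ε i && A i l))) := by
    intro ε
    rw [erm_flatPt_cons]
    simp only [Bool.true_and]
    exact hF (fun l => p l ^^ decide (Odd #(univ.filter fun i : Fin 3 => ε i && A i l)))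
  rw [sum_congr rfl fun ε _ => h0 ε, sum_congr rfl fun ε _ => h1 ε, two_mul]

set_option maxHeartbeats 4000000 in
/-- **The Pfaffian carry (11-bit identity).**  For `q` of degree `≤ 2` with alternating form `B`, on every parametrised 4-flat
`p ⊕ ⟨t,a,b,c⟩`: `#{ones of q} ≡ 2·Pf(t;a,b,c) (mod 4)`.  (All sixteen values of `q` are determined by `q(p)`, the four
`q(p ⊕ y)` and the six `B(y,z)` — `es_second_deriv` — and the claim is then a finite check.)  NOT summit progress. [this work] -/
theorem pp_q16 (q : (Fin n → Bool) → Bool) (hq : IsDegLeFun 2 q) (p t a b c : Fin n → Bool) :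
    (∑ ε : Fin 4 → Bool, (if q (fun l => p l ^^ decide (Odd #(univ.filter fun i : Fin 4 => ε i &&
        (Fin.cons t (Fin.cons a (Fin.cons b (Fin.cons c (fun i : Fin 0 => i.elim0) : Fin 1 → Fin n → Bool)
          : Fin 2 → Fin n → Bool) : Fin 3 → Fin n → Bool) : Fin 4 → Fin n → Bool) i l))) = true then 1 else 0 : ℤ)) % 4 =
      (2 * (if ((((q zeroVec ^^ q a ^^ q t ^^ q (bxor a t)) && (q zeroVec ^^ q c ^^ q b ^^ q (bxor c b))) ^^
        ((q zeroVec ^^ q b ^^ q t ^^ q (bxor b t)) && (q zeroVec ^^ q c ^^ q a ^^ q (bxor c a)))) ^^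
        ((q zeroVec ^^ q c ^^ q t ^^ q (bxor c t)) && (q zeroVec ^^ q b ^^ q a ^^ q (bxor b a)))) = true
        then 1 else 0 : ℤ)) % 4 := by
  simp only [tep_sum_split, Fintype.sum_unique, fl_pt_four, Bool.true_and, Bool.false_and, es_bxor_false,
    show (fun j => a j) = a from rfl, show (fun j => b j) = b from rfl, show (fun j => c j) = c from rfl,
    show (fun j => t j) = t from rfl]
  simp only [es_second_deriv q hq]
  generalize (q zeroVec ^^ q a ^^ q t ^^ q (bxor a t)) = y₁
  generalize (q zeroVec ^^ q c ^^ q b ^^ q (bxor c b)) = y₂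
  generalize (q zeroVec ^^ q b ^^ q t ^^ q (bxor b t)) = y₃
  generalize (q zeroVec ^^ q c ^^ q a ^^ q (bxor c a)) = y₄
  generalize (q zeroVec ^^ q c ^^ q t ^^ q (bxor c t)) = y₅
  generalize (q zeroVec ^^ q b ^^ q a ^^ q (bxor b a)) = y₆
  generalize q (bxor p c) = x₁
  generalize q (bxor p b) = x₂
  generalize q (bxor p a) = x₃
  generalize q (bxor p t) = x₄
  generalize q p = x₀
  revert x₀ x₁ x₂ x₃ x₄ y₁ y₂ y₃ y₄ y₅ y₆
  decide

set_option maxHeartbeats 1600000 in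
/-- **Periods of `e` kill the Pfaffian form (with base point).**  `g` cubic on 14 bits, `W_g = 32u`,
`u ≡ 5 − 2q − 4e (mod 8)` with `q` quadratic; if `e(x ⊕ t) = e(x)` for all `x` then `Pf(t;a,b,c) = 0` for all `a,b,c`
(`8 ∣ Σ_{p⊕⟨t,a,b,c⟩} u` by `fs_flat_sum_dvd`, the `e`-part pairs up along `t`, and `pp_q16`).  NOT summit progress. [this work] -/
theorem pp_period_pf_at (g : (Fin (7 + 7) → Bool) → Bool) (hg : IsDegLeFun 3 g)
    (u : (Fin (7 + 7) → Bool) → ℤ) (hu : ∀ x, W (fun y => signOf (g y)) x = (2 : ℝ) ^ 5 * (u x : ℝ))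
    (q e : (Fin (7 + 7) → Bool) → Bool) (hq : IsDegLeFun 2 q)
    (hmod : ∀ x, (8 : ℤ) ∣ u x - 5 + 2 * (if q x = true then 1 else 0 : ℤ) + 4 * (if e x = true then 1 else 0 : ℤ))
    (t : Fin (7 + 7) → Bool) (ht : ∀ x, e (bxor x t) = e x) (p a b c : Fin (7 + 7) → Bool) :
    ((((q zeroVec ^^ q a ^^ q t ^^ q (bxor a t)) && (q zeroVec ^^ q c ^^ q b ^^ q (bxor c b))) ^^
      ((q zeroVec ^^ q b ^^ q t ^^ q (bxor b t)) && (q zeroVec ^^ q c ^^ q a ^^ q (bxor c a)))) ^^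
      ((q zeroVec ^^ q c ^^ q t ^^ q (bxor c t)) && (q zeroVec ^^ q b ^^ q a ^^ q (bxor b a)))) = false := by
  classical
  have h8 := fs_flat_sum_dvd (e := 3) g u hg hu p
    (Fin.cons t (Fin.cons a (Fin.cons b (Fin.cons c (fun i : Fin 0 => i.elim0) : Fin 1 → Fin (7 + 7) → Bool)
      : Fin 2 → Fin (7 + 7) → Bool) : Fin 3 → Fin (7 + 7) → Bool) : Fin 4 → Fin (7 + 7) → Bool) (by norm_num)
  have hm8 : (8 : ℤ) ∣ ∑ ε : Fin 4 → Bool, (u (fun l => p l ^^ decide (Odd #(univ.filter fun i : Fin 4 => ε i &&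
      (Fin.cons t (Fin.cons a (Fin.cons b (Fin.cons c (fun i : Fin 0 => i.elim0) : Fin 1 → Fin (7 + 7) → Bool)
        : Fin 2 → Fin (7 + 7) → Bool) : Fin 3 → Fin (7 + 7) → Bool) : Fin 4 → Fin (7 + 7) → Bool) i l))) - 5 +
      2 * (if q (fun l => p l ^^ decide (Odd #(univ.filter fun i : Fin 4 => ε i &&
      (Fin.cons t (Fin.cons a (Fin.cons b (Fin.cons c (fun i : Fin 0 => i.elim0) : Fin 1 → Fin (7 + 7) → Bool)
        : Fin 2 → Fin (7 + 7) → Bool) : Fin 3 → Fin (7 + 7) → Bool) : Fin 4 → Fin (7 + 7) → Bool) i l))) = true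
        then 1 else 0 : ℤ) +
      4 * (if e (fun l => p l ^^ decide (Odd #(univ.filter fun i : Fin 4 => ε i &&
      (Fin.cons t (Fin.cons a (Fin.cons b (Fin.cons c (fun i : Fin 0 => i.elim0) : Fin 1 → Fin (7 + 7) → Bool)
        : Fin 2 → Fin (7 + 7) → Bool) : Fin 3 → Fin (7 + 7) → Bool) : Fin 4 → Fin (7 + 7) → Bool) i l))) = true
        then 1 else 0 : ℤ)) :=
    dvd_sum fun ε _ => hmod _
  have hq16 := pp_q16 q hq p t a b c
  have hpair := pp_pair_sum (fun x => if e x = true then (1 : ℤ) else 0) p t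
    (Fin.cons a (Fin.cons b (Fin.cons c (fun i : Fin 0 => i.elim0) : Fin 1 → Fin (7 + 7) → Bool)
      : Fin 2 → Fin (7 + 7) → Bool) : Fin 3 → Fin (7 + 7) → Bool) (fun x => by rw [ht])
  have h80 : Fintype.card (Fin 4 → Bool) • (5 : ℤ) = 80 := by
    rw [Fintype.card_fun, Fintype.card_bool, Fintype.card_fin]; norm_num
  rw [sum_add_distrib, sum_add_distrib, sum_sub_distrib, ← mul_sum, ← mul_sum, sum_const, card_univ, h80, hpair] at hm8
  rw [show (2 : ℤ) ^ 3 = 8 from by norm_num] at h8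
  by_contra hne
  rw [Bool.not_eq_false] at hne
  rw [hne, if_pos rfl] at hq16
  generalize (∑ ε : Fin 4 → Bool, u (fun l => p l ^^ decide (Odd #(univ.filter fun i : Fin 4 => ε i &&
      (Fin.cons t (Fin.cons a (Fin.cons b (Fin.cons c (fun i : Fin 0 => i.elim0) : Fin 1 → Fin (7 + 7) → Bool)
        : Fin 2 → Fin (7 + 7) → Bool) : Fin 3 → Fin (7 + 7) → Bool) : Fin 4 → Fin (7 + 7) → Bool) i l)))) = S₁ at h8 hm8
  generalize (∑ ε : Fin 4 → Bool, (if q (fun l => p l ^^ decide (Odd #(univ.filter fun i : Fin 4 => ε i &&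
      (Fin.cons t (Fin.cons a (Fin.cons b (Fin.cons c (fun i : Fin 0 => i.elim0) : Fin 1 → Fin (7 + 7) → Bool)
        : Fin 2 → Fin (7 + 7) → Bool) : Fin 3 → Fin (7 + 7) → Bool) : Fin 4 → Fin (7 + 7) → Bool) i l))) = true
        then 1 else 0 : ℤ)) = S₂ at hm8 hq16
  generalize (∑ ε : Fin 3 → Bool, (if e (fun l => p l ^^ decide (Odd #(univ.filter fun i : Fin 3 => ε i &&
      (Fin.cons a (Fin.cons b (Fin.cons c (fun i : Fin 0 => i.elim0) : Fin 1 → Fin (7 + 7) → Bool)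
        : Fin 2 → Fin (7 + 7) → Bool) : Fin 3 → Fin (7 + 7) → Bool) i l))) = true then 1 else 0 : ℤ)) = S₃ at hm8
  omega

/-- **Periods of `e` kill the Pfaffian form.**  As `pp_period_pf_at`: for every period `t` of `e`, `Pf(t;a,b,c) = 0` for all
`a, b, c`.  NOT summit progress. [this work] -/
theorem pp_period_pf (g : (Fin (7 + 7) → Bool) → Bool) (hg : IsDegLeFun 3 g)
    (u : (Fin (7 + 7) → Bool) → ℤ) (hu : ∀ x, W (fun y => signOf (g y)) x = (2 : ℝ) ^ 5 * (u x : ℝ))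
    (q e : (Fin (7 + 7) → Bool) → Bool) (hq : IsDegLeFun 2 q)
    (hmod : ∀ x, (8 : ℤ) ∣ u x - 5 + 2 * (if q x = true then 1 else 0 : ℤ) + 4 * (if e x = true then 1 else 0 : ℤ))
    (t : Fin (7 + 7) → Bool) (ht : ∀ x, e (bxor x t) = e x) (a b c : Fin (7 + 7) → Bool) :
    ((((q zeroVec ^^ q a ^^ q t ^^ q (bxor a t)) && (q zeroVec ^^ q c ^^ q b ^^ q (bxor c b))) ^^
      ((q zeroVec ^^ q b ^^ q t ^^ q (bxor b t)) && (q zeroVec ^^ q c ^^ q a ^^ q (bxor c a)))) ^^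
      ((q zeroVec ^^ q c ^^ q t ^^ q (bxor c t)) && (q zeroVec ^^ q b ^^ q a ^^ q (bxor b a)))) = false :=
  pp_period_pf_at g hg u hu q e hq hmod t ht zeroVec a b c

end Summit.QuantumAdvantage.QuantumAdvantage.Theorems.NearExactIsExact.Negative.PfaffianPeriodFourteen

end
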